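import Literature.NumberTheory.Transcendental.KZUnfoldedStokes
import Literature.NumberTheory.Transcendental.NashCubes
import Mathlib.Analysis.Calculus.Deriv.Mul
import Mathlib.Analysis.Calculus.Deriv.Pi
import Mathlib.Analysis.Calculus.Deriv.Add
import Mathlib.Analysis.Calculus.Deriv.Comp
import Mathlib.Analysis.Normed.Operator.BoundedLinearMaps
import Mathlib.MeasureTheory.Integral.Prod
import Mathlib.MeasureTheory.Constructions.Pi
import HarnessLib

/-!
# Soundness of the unfolded Stokes relators

Companion to `KZUnfoldedStokes.lean` (definition request `defn-KZ.unfoldedStokesRel`, route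
KontsevichZagierPeriods/UnfoldedStokes). There `KZ.unfoldedStokesRel : Set KZ.FormalRep` is the
set of formal combinations
`Σⱼ (−1)ʲ ([Fⱼ¹ × (0,1), Ω gⱼ] − [Fⱼ⁰ × (0,1), Ω gⱼ]) − [D, ω ∧ η] − [D × (0,1), Ω · dη]`
(`KZ.stokesRelator`) over all unfolded Stokes data `D : KZ.UnfoldedStokesData n` on the unit
`(n+1)`-cube and all representations carrying `D`. This file proves, from Mathlib's integration
theory and with no named fact, that every such relator **evaluates to zero**
(`KZ.eval_eq_zero_of_mem_unfoldedStokesRel`), i.e. Stokes' formula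
`∫_{∂D} f η = ∫_D ω ∧ η + ∫_D f dη` on the unit cube for the abelian integral
`f(p) = ∫₀¹ Ω(p, u) du`, `Ω(p, u) = Σᵢ pᵢ aᵢ(u p)`, of the closed `1`-form `ω = Σ aᵢ dpᵢ`
[Kontsevich–Zagier 2001, §1.2, rule 3): "replace the Newton–Leibniz formula by Stokes's
formula"]. Consequently the Stokes relations lie in the kernel of evaluation
(`KZ.stokesRelations_le_ker_eval`), so that thesis part B of the route ("Stokes generation",
`eval.ker ≤ stokesRelations`) asserts an equality.

## Proof

Everything is unfolded into iterated one-variable integrals, exactly as the route's derivation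
by moves does, so that `f` is never differentiated under the integral sign:

* `KZ.setIntegral_unitCube_succ` — Fubini along one coordinate of the cube: `∫_{(0,1)ᵐ⁺¹} F` is
  the iterated integral over `(0,1)ᵐ` of the integrals along the coordinate `j`
  (`MeasurableEquiv.piFinSuccAbove`, `volume_preserving_piFinSuccAbove`, `integral_prod_symm`);
* `UnfoldedStokesData.hasDerivAt_unfolding_insertNth` — **closedness, unfolded**: along the
  `j`-th coordinate, `∂ⱼ Ω(p, u) = aⱼ(u p) + u Σᵢ pᵢ ∂ⱼaᵢ(u p) = aⱼ(u p) + u · Daⱼ(u p) p`, which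
  is the radial derivative `∂ᵤ (u · aⱼ(u p))` (`UnfoldedStokesData.hasDerivAt_mul_a_smul`);
* `UnfoldedStokesData.integral_face_deriv`, `UnfoldedStokesData.value_face_sub` — by the
  fundamental theorem of calculus in `pⱼ`, `[Fⱼ¹ × (0,1), Ω gⱼ] − [Fⱼ⁰ × (0,1), Ω gⱼ]` evaluates
  to `∫_{D × (0,1)} (∂ᵤ(u aⱼ(u p)) gⱼ(p) + Ω ∂ⱼgⱼ)`;
* `UnfoldedStokesData.integral_radial`, `UnfoldedStokesData.integral_radialIntegrand` — by the
  fundamental theorem of calculus in `u`, `∫₀¹ ∂ᵤ(u aⱼ(u p)) du = aⱼ(p)`, so the alternating sum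
  of the first terms is `∫_D Σ (−1)ʲ aⱼ gⱼ = ∫_D ω ∧ η`, while that of the second terms is
  `∫_{D × (0,1)} Ω · Σ (−1)ʲ ∂ⱼ gⱼ = [D × (0,1), Ω dη]`;
* `UnfoldedStokesData.eval_stokesRelator_eq_zero` assembles the pieces.

All integrands are continuous on the closed cubes (the data are `C¹` on an open `U ⊇ [0,1]ⁿ⁺¹`
star-shaped about `0`, so `u p ∈ U` throughout), hence integrable.

## References

* M. Kontsevich, D. Zagier, *Periods*, in: Mathematics Unlimited — 2001 and Beyond, Springer
  (2001), 771–808 [KontsevichZagierPeriods2001], §1.2 rule 3) and §4.1, relation (3).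
* R. Bott, L. W. Tu, *Differential Forms in Algebraic Topology*, GTM 82, Springer (1982)
  [BottTu1982Forms], §4 (homotopy operator of the Poincaré lemma).

## Design notes

* Theorems only: no definition and no named fact is added (the auxiliary integrands are written
  out); nothing in `KZUnfoldedStokes.lean` is restated or changed.
-/

noncomputable section

open MeasureTheory Set

namespace Literature.NumberTheory.Transcendental

namespace KZ

variable {m n : ℕ}

/-! ### Soundness: the relators evaluate to zero -/

section Soundness

/-- The open unit cube of this calculus is the open unit cube `openUnitCube` of `NashCubes.lean`
(cells of Nash cubical chains); both are `{x | ∀ i, x i ∈ Set.Ioo 0 1}`. [folklore] -/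
theorem unitCube_eq_openUnitCube (m : ℕ) : unitCube m = openUnitCube m := rfl

/-- The open unit cube is `ℚ`-semialgebraic. [folklore] -/
theorem isSemialgebraic_unitCube (m : ℕ) :
    Literature.ModelTheory.ExponentialFields.IsSemialgebraic ℚ (unitCube m) :=
  isSemialgebraic_openUnitCube

/-- Membership in the `(m+1)`-cube, split along the coordinate `j`. [folklore] -/
theorem mem_unitCube_succ_iff (j : Fin (m + 1)) (x : Fin (m + 1) → ℝ) :
    x ∈ unitCube (m + 1) ↔ x j ∈ Ioo (0 : ℝ) 1 ∧ j.removeNth x ∈ unitCube m := by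
  simp only [mem_unitCube, Fin.forall_iff_succAbove j, Fin.removeNth_apply]

/-- The `(m+1)`-cube is the preimage of `(0,1) × (0,1)ᵐ` under the measurable equivalence
splitting off the coordinate `j`. [folklore] -/
theorem preimage_piFinSuccAbove_prod_unitCube (j : Fin (m + 1)) :
    (MeasurableEquiv.piFinSuccAbove (fun _ => ℝ) j) ⁻¹' (Ioo (0 : ℝ) 1 ×ˢ unitCube m) =
      unitCube (m + 1) := by
  ext x
  rw [mem_preimage, mem_prod, mem_unitCube_succ_iff j]
  rfl

/-- **Fubini along one coordinate of the cube**: an integral over `(0,1)ᵐ⁺¹` is an iterated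
integral, over `(0,1)ᵐ` of the integrals along the coordinate `j`. [folklore] -/
theorem setIntegral_unitCube_succ (j : Fin (m + 1)) (F : (Fin (m + 1) → ℝ) → ℝ)
    (hF : IntegrableOn F (unitCube (m + 1))) :
    ∫ x in unitCube (m + 1), F x =
      ∫ q in unitCube m, ∫ t in Ioo (0 : ℝ) 1, F (j.insertNth t q) := by
  set e := MeasurableEquiv.piFinSuccAbove (fun _ => ℝ) j with he_def
  have he : MeasurePreserving e volume volume := volume_preserving_piFinSuccAbove (fun _ => ℝ) j
  have he_symm : ∀ p : ℝ × (Fin m → ℝ), e.symm p = j.insertNth p.1 p.2 := fun p => rfl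
  have hpre : e ⁻¹' (Ioo (0 : ℝ) 1 ×ˢ unitCube m) = unitCube (m + 1) :=
    preimage_piFinSuccAbove_prod_unitCube j
  have hcomp : ∀ x, (F ∘ e.symm) (e x) = F x := fun x => by simp
  have hInt : Integrable (F ∘ e.symm)
      ((volume.restrict (Ioo (0 : ℝ) 1)).prod (volume.restrict (unitCube m))) := by
    have h : IntegrableOn (F ∘ e.symm) (Ioo (0 : ℝ) 1 ×ˢ unitCube m) volume := by
      rw [← he.integrableOn_comp_preimage e.measurableEmbedding, hpre]
      exact hF.congr_fun (fun x _ => (hcomp x).symm) (isOpen_unitCube _).measurableSet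
    rw [Measure.prod_restrict, ← Measure.volume_eq_prod]
    exact h
  calc ∫ x in unitCube (m + 1), F x
      = ∫ x in e ⁻¹' (Ioo (0 : ℝ) 1 ×ˢ unitCube m), (F ∘ e.symm) (e x) := by
        rw [hpre]
        exact setIntegral_congr_fun (isOpen_unitCube _).measurableSet fun x _ => (hcomp x).symm
    _ = ∫ p in Ioo (0 : ℝ) 1 ×ˢ unitCube m, (F ∘ e.symm) p :=
        he.setIntegral_preimage_emb e.measurableEmbedding _ _
    _ = ∫ p, (F ∘ e.symm) p ∂((volume.restrict (Ioo (0 : ℝ) 1)).prod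
          (volume.restrict (unitCube m))) := by
        rw [Measure.prod_restrict, ← Measure.volume_eq_prod]
    _ = ∫ q in unitCube m, ∫ t in Ioo (0 : ℝ) 1, (F ∘ e.symm) (t, q) := integral_prod_symm _ hInt
    _ = ∫ q in unitCube m, ∫ t in Ioo (0 : ℝ) 1, F (j.insertNth t q) := rfl

/-- `Fin.init` of a vector with a value inserted at `j.castSucc` is the insertion at `j` into
`Fin.init`. [folklore] -/
theorem init_insertNth_castSucc (j : Fin (n + 1)) (t : ℝ) (y : Fin (n + 1) → ℝ) :
    Fin.init (j.castSucc.insertNth t y : Fin (n + 2) → ℝ) = j.insertNth t (Fin.init y) := by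
  ext i
  refine Fin.succAboveCases j ?_ (fun k => ?_) i
  · simp only [Fin.init, Fin.insertNth_apply_same]
  · rw [Fin.insertNth_apply_succAbove]
    simp only [Fin.init]
    rw [← Fin.castSucc_succAbove_castSucc, Fin.insertNth_apply_succAbove]

/-- The last coordinate of a vector with a value inserted at `j.castSucc`. [folklore] -/
theorem insertNth_castSucc_apply_last (j : Fin (n + 1)) (t : ℝ) (y : Fin (n + 1) → ℝ) :
    (j.castSucc.insertNth t y : Fin (n + 2) → ℝ) (Fin.last (n + 1)) = y (Fin.last n) := by
  have h : Fin.last (n + 1) = j.castSucc.succAbove (Fin.last n) := by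
    rw [Fin.succAbove_of_le_castSucc _ _ (Fin.castSucc_le_castSucc_iff.2 (Fin.le_last j)),
      Fin.succ_last]
  rw [h, Fin.insertNth_apply_succAbove]

/-- Inserting `s` at `j` is updating the `j`-th coordinate of the insertion of `0`. [folklore] -/
theorem insertNth_eq_update (j : Fin (n + 1)) (s : ℝ) (q : Fin n → ℝ) :
    (j.insertNth s q : Fin (n + 1) → ℝ) = Function.update (j.insertNth 0 q) j s := by
  rw [← Fin.insertNth_removeNth, Fin.removeNth_insertNth]

/-- The straight line `s ↦ insertNth j s q` has velocity `Pi.single j 1`. [folklore] -/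
theorem hasDerivAt_insertNth (j : Fin (n + 1)) (q : Fin n → ℝ) (t : ℝ) :
    HasDerivAt (fun s => (j.insertNth s q : Fin (n + 1) → ℝ)) (Pi.single j 1) t := by
  have h := hasDerivAt_update (j.insertNth (0 : ℝ) q) j t
  refine h.congr_of_eventuallyEq (Filter.Eventually.of_forall fun s => ?_)
  exact insertNth_eq_update j s q

/-- A vector is the combination of the coordinate vectors with its coordinates. [folklore] -/
theorem sum_smul_single (x : Fin m → ℝ) : ∑ i, x i • (Pi.single i (1 : ℝ) : Fin m → ℝ) = x := by
  conv_rhs => rw [← Finset.univ_sum_single x]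
  refine Finset.sum_congr rfl fun i _ => ?_
  rw [← Pi.single_smul', smul_eq_mul, mul_one]

namespace UnfoldedStokesData

variable (D : UnfoldedStokesData n)

/-- The coefficients `aᵢ` are continuous on `U`. [folklore] -/
theorem continuousOn_a (i : Fin (n + 1)) : ContinuousOn (D.a i) D.U :=
  (D.contDiffOn_a i).continuousOn

/-- The coefficients `gⱼ` are continuous on `U`. [folklore] -/
theorem continuousOn_g (j : Fin (n + 1)) : ContinuousOn (D.g j) D.U :=
  (D.contDiffOn_g j).continuousOn

/-- The derivatives of the `aᵢ` are continuous on `U`. [folklore] -/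
theorem continuousOn_fderiv_a (i : Fin (n + 1)) :
    ContinuousOn (fun x => fderiv ℝ (D.a i) x) D.U :=
  (D.contDiffOn_a i).continuousOn_fderiv_of_isOpen D.isOpen le_rfl

/-- The derivatives of the `gⱼ` are continuous on `U`. [folklore] -/
theorem continuousOn_fderiv_g (j : Fin (n + 1)) :
    ContinuousOn (fun x => fderiv ℝ (D.g j) x) D.U :=
  (D.contDiffOn_g j).continuousOn_fderiv_of_isOpen D.isOpen le_rfl

/-- The `aᵢ` are differentiable at the points of `U`. [folklore] -/
theorem hasFDerivAt_a (i : Fin (n + 1)) {x : Fin (n + 1) → ℝ} (hx : x ∈ D.U) :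
    HasFDerivAt (D.a i) (fderiv ℝ (D.a i) x) x :=
  (((D.contDiffOn_a i).differentiableOn one_ne_zero).differentiableAt
    (D.isOpen.mem_nhds hx)).hasFDerivAt

/-- The `gⱼ` are differentiable at the points of `U`. [folklore] -/
theorem hasFDerivAt_g (j : Fin (n + 1)) {x : Fin (n + 1) → ℝ} (hx : x ∈ D.U) :
    HasFDerivAt (D.g j) (fderiv ℝ (D.g j) x) x :=
  (((D.contDiffOn_g j).differentiableOn one_ne_zero).differentiableAt
    (D.isOpen.mem_nhds hx)).hasFDerivAt

/-- Points of the closed cube lie in `U`. [folklore] -/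
theorem mem_U_of_mem_Icc {x : Fin (n + 1) → ℝ} (hx : x ∈ Icc (0 : Fin (n + 1) → ℝ) 1) :
    x ∈ D.U :=
  D.Icc_subset hx

/-- Scalings by `u ∈ [0,1]` of points of the closed cube lie in `U`. [folklore] -/
theorem smul_mem_U_of_mem_Icc {x : Fin (n + 1) → ℝ} (hx : x ∈ Icc (0 : Fin (n + 1) → ℝ) 1)
    {u : ℝ} (hu : u ∈ Icc (0 : ℝ) 1) : u • x ∈ D.U :=
  D.smul_mem x (D.Icc_subset hx) u hu

/-- **The radial derivative.** `d/du (u · aⱼ(u p)) = aⱼ(u p) + u · Daⱼ(u p) p`. [folklore] -/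
theorem hasDerivAt_mul_a_smul (j : Fin (n + 1)) (p : Fin (n + 1) → ℝ) {u : ℝ}
    (hu : u • p ∈ D.U) :
    HasDerivAt (fun v => v * D.a j (v • p))
      (D.a j (u • p) + u * fderiv ℝ (D.a j) (u • p) p) u := by
  have hpath : HasDerivAt (fun v : ℝ => v • p) p u := by
    simpa using (hasDerivAt_id u).smul_const p
  have hcomp : HasDerivAt (fun v : ℝ => D.a j (v • p)) (fderiv ℝ (D.a j) (u • p) p) u :=
    (D.hasFDerivAt_a j hu).comp_hasDerivAt u hpath
  have := (hasDerivAt_id' u).fun_mul hcomp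
  simpa using this

/-- **The closedness of `ω`, unfolded**: `d/dt Ω(insertNth j t q, u) = aⱼ(u x) + u · Daⱼ(u x) x`
at `x = insertNth j t q` — the derivative of the unfolding integrand along the `j`-th coordinate
is the radial derivative of `u ↦ u · aⱼ(u x)` (using `∂ⱼ aᵢ = ∂ᵢ aⱼ` at `u x`). [folklore] -/
theorem hasDerivAt_unfolding_insertNth (j : Fin (n + 1)) (q : Fin n → ℝ) (u t : ℝ)
    (hux : u • (j.insertNth t q : Fin (n + 1) → ℝ) ∈ D.U) :
    HasDerivAt (fun s => unfolding D.a (j.insertNth s q) u)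
      (D.a j (u • (j.insertNth t q : Fin (n + 1) → ℝ)) +
        u * fderiv ℝ (D.a j) (u • (j.insertNth t q : Fin (n + 1) → ℝ)) (j.insertNth t q)) t := by
  set x : Fin (n + 1) → ℝ := j.insertNth t q with hx_def
  have hpath := hasDerivAt_insertNth j q t
  -- each summand `s ↦ (ins s) i * a i (u • ins s)`
  have hsum : HasDerivAt (fun s => unfolding D.a (j.insertNth s q) u)
      (∑ i, ((Pi.single j (1 : ℝ) : Fin (n + 1) → ℝ) i * D.a i (u • x) +
        x i * (fderiv ℝ (D.a i) (u • x) (u • Pi.single j 1)))) t := by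
    simp only [unfolding]
    refine HasDerivAt.fun_sum fun i _ => ?_
    have h1 : HasDerivAt (fun s => (j.insertNth s q : Fin (n + 1) → ℝ) i)
        ((Pi.single j (1 : ℝ) : Fin (n + 1) → ℝ) i) t :=
      ((ContinuousLinearMap.proj (R := ℝ) (φ := fun _ : Fin (n + 1) => ℝ) i).hasFDerivAt
        ).comp_hasDerivAt t hpath
    have h2 : HasDerivAt (fun s => u • (j.insertNth s q : Fin (n + 1) → ℝ))
        (u • Pi.single j 1) t := hpath.const_smul u
    have h3 : HasDerivAt (fun s => D.a i (u • (j.insertNth s q : Fin (n + 1) → ℝ)))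
        (fderiv ℝ (D.a i) (u • x) (u • Pi.single j 1)) t :=
      (D.hasFDerivAt_a i hux).comp_hasDerivAt t h2
    exact h1.mul h3
  refine hsum.congr_deriv ?_
  -- rewrite the derivative using closedness and linearity
  have hclosed : ∀ i, fderiv ℝ (D.a i) (u • x) (Pi.single j 1) =
      fderiv ℝ (D.a j) (u • x) (Pi.single i 1) := fun i => D.closed i j (u • x) hux
  simp only [map_smul, smul_eq_mul, Finset.sum_add_distrib]
  congr 1
  · simp [Pi.single_apply]
  · simp_rw [hclosed]
    have hlin : ∑ i, x i * fderiv ℝ (D.a j) (u • x) (Pi.single i 1) =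
        fderiv ℝ (D.a j) (u • x) x := by
      have h : fderiv ℝ (D.a j) (u • x) x =
          fderiv ℝ (D.a j) (u • x) (∑ i, x i • (Pi.single i (1 : ℝ) : Fin (n + 1) → ℝ)) := by
        rw [sum_smul_single]
      rw [h, map_sum]
      refine Finset.sum_congr rfl fun i _ => ?_
      rw [map_smul, smul_eq_mul]
    rw [← hlin, Finset.mul_sum]
    refine Finset.sum_congr rfl fun i _ => ?_
    ring

/-! #### Continuity of the integrands -/

section Continuity

variable {X : Type*} [TopologicalSpace X] {S : Set X}

/-- `x ↦ aᵢ(Q x)` is continuous where `Q` is continuous with values in `U`. [folklore] -/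
theorem continuousOn_a_comp (i : Fin (n + 1)) {Q : X → (Fin (n + 1) → ℝ)} (hQ : ContinuousOn Q S)
    (hmem : ∀ x ∈ S, Q x ∈ D.U) : ContinuousOn (fun x => D.a i (Q x)) S :=
  (D.continuousOn_a i).comp hQ hmem

/-- `x ↦ gⱼ(Q x)` is continuous where `Q` is continuous with values in `U`. [folklore] -/
theorem continuousOn_g_comp (j : Fin (n + 1)) {Q : X → (Fin (n + 1) → ℝ)} (hQ : ContinuousOn Q S)
    (hmem : ∀ x ∈ S, Q x ∈ D.U) : ContinuousOn (fun x => D.g j (Q x)) S :=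
  (D.continuousOn_g j).comp hQ hmem

/-- `x ↦ Daᵢ(Q x)(v x)` is continuous where `Q`, `v` are continuous and `Q` takes values in `U`.
[folklore] -/
theorem continuousOn_fderiv_a_comp (i : Fin (n + 1)) {Q v : X → (Fin (n + 1) → ℝ)}
    (hQ : ContinuousOn Q S) (hmem : ∀ x ∈ S, Q x ∈ D.U) (hv : ContinuousOn v S) :
    ContinuousOn (fun x => fderiv ℝ (D.a i) (Q x) (v x)) S :=
  ((D.continuousOn_fderiv_a i).comp hQ hmem).clm_apply hv

/-- `x ↦ Dgⱼ(Q x)(v x)` is continuous where `Q`, `v` are continuous and `Q` takes values in `U`.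
[folklore] -/
theorem continuousOn_fderiv_g_comp (j : Fin (n + 1)) {Q v : X → (Fin (n + 1) → ℝ)}
    (hQ : ContinuousOn Q S) (hmem : ∀ x ∈ S, Q x ∈ D.U) (hv : ContinuousOn v S) :
    ContinuousOn (fun x => fderiv ℝ (D.g j) (Q x) (v x)) S :=
  ((D.continuousOn_fderiv_g j).comp hQ hmem).clm_apply hv

/-- `x ↦ Ω(P x, u x)` is continuous where `P`, `u` are continuous and `u x • P x ∈ U`. [folklore] -/
theorem continuousOn_unfolding_comp {P : X → (Fin (n + 1) → ℝ)} {u : X → ℝ}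
    (hP : ContinuousOn P S) (hu : ContinuousOn u S) (hmem : ∀ x ∈ S, u x • P x ∈ D.U) :
    ContinuousOn (fun x => unfolding D.a (P x) (u x)) S := by
  simp only [unfolding]
  refine continuousOn_finsetSum _ fun i _ => ?_
  exact ((continuous_apply i).comp_continuousOn hP).mul
    (D.continuousOn_a_comp i (hu.smul hP) hmem)

/-- `x ↦ aⱼ(u P) + u · Daⱼ(u P) P` (the radial derivative) is continuous where `P`, `u` are
continuous and `u x • P x ∈ U`. [folklore] -/
theorem continuousOn_radial_comp (j : Fin (n + 1)) {P : X → (Fin (n + 1) → ℝ)} {u : X → ℝ}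
    (hP : ContinuousOn P S) (hu : ContinuousOn u S) (hmem : ∀ x ∈ S, u x • P x ∈ D.U) :
    ContinuousOn (fun x => D.a j (u x • P x) + u x * fderiv ℝ (D.a j) (u x • P x) (P x)) S :=
  (D.continuousOn_a_comp j (hu.smul hP) hmem).add
    (hu.mul (D.continuousOn_fderiv_a_comp j (hu.smul hP) hmem hP))

end Continuity

/-! #### Points of the cubes -/

/-- `Fin.init` maps the closed `(n+2)`-cube into the closed `(n+1)`-cube. [folklore] -/
theorem init_mem_Icc {z : Fin (n + 2) → ℝ} (hz : z ∈ Icc (0 : Fin (n + 2) → ℝ) 1) :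
    Fin.init z ∈ Icc (0 : Fin (n + 1) → ℝ) 1 :=
  ⟨fun _ => hz.1 _, fun _ => hz.2 _⟩

/-- The last coordinate of a point of the closed cube lies in `[0,1]`. [folklore] -/
theorem apply_mem_Icc {k : ℕ} {z : Fin k → ℝ} (hz : z ∈ Icc (0 : Fin k → ℝ) 1) (i : Fin k) :
    z i ∈ Icc (0 : ℝ) 1 :=
  ⟨hz.1 i, hz.2 i⟩

/-- Inserting a coordinate in `[0,1]` into a point of the closed cube gives a point of the closed
cube. [folklore] -/
theorem insertNth_mem_Icc' (j : Fin (n + 1)) {t : ℝ} (ht : t ∈ Icc (0 : ℝ) 1) {q : Fin n → ℝ}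
    (hq : q ∈ Icc (0 : Fin n → ℝ) 1) : (j.insertNth t q : Fin (n + 1) → ℝ) ∈ Icc 0 1 := by
  rw [Fin.insertNth_mem_Icc]
  exact ⟨ht, hq⟩

/-- `Fin.init` maps the closed `(n+1)`-cube into the closed `n`-cube. [folklore] -/
theorem init_mem_Icc' {y : Fin (n + 1) → ℝ} (hy : y ∈ Icc (0 : Fin (n + 1) → ℝ) 1) :
    Fin.init y ∈ Icc (0 : Fin n → ℝ) 1 :=
  ⟨fun _ => hy.1 _, fun _ => hy.2 _⟩

/-! #### The fundamental theorem of calculus in the radial variable -/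

/-- **Radial FTC**: `∫₀¹ (aⱼ(u p) + u · Daⱼ(u p) p) du = aⱼ(p)` for `p` in the closed cube
(`u ↦ u · aⱼ(u p)` is a primitive, vanishing at `u = 0`). [folklore] -/
theorem integral_radial (j : Fin (n + 1)) {p : Fin (n + 1) → ℝ}
    (hp : p ∈ Icc (0 : Fin (n + 1) → ℝ) 1) :
    ∫ u in Ioo (0 : ℝ) 1, (D.a j (u • p) + u * fderiv ℝ (D.a j) (u • p) p) = D.a j p := by
  have hmem : ∀ u ∈ Icc (0 : ℝ) 1, u • p ∈ D.U := fun u hu => D.smul_mem_U_of_mem_Icc hp hu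
  have hpath : ContinuousOn (fun u : ℝ => u • p) (Icc 0 1) :=
    (continuous_id.smul continuous_const).continuousOn
  have hcont : ContinuousOn (fun u : ℝ => u * D.a j (u • p)) (Icc 0 1) :=
    continuousOn_id.mul ((D.continuousOn_a j).comp hpath hmem)
  have hθ : ContinuousOn (fun u : ℝ => D.a j (u • p) + u * fderiv ℝ (D.a j) (u • p) p)
      (Icc 0 1) :=
    D.continuousOn_radial_comp j continuousOn_const continuousOn_id hmem
  have hderiv : ∀ u ∈ Ioo (0 : ℝ) 1, HasDerivAt (fun v : ℝ => v * D.a j (v • p))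
      (D.a j (u • p) + u * fderiv ℝ (D.a j) (u • p) p) u := fun u hu =>
    D.hasDerivAt_mul_a_smul j p (hmem u (Ioo_subset_Icc_self hu))
  rw [← integral_Ioc_eq_integral_Ioo, ← intervalIntegral.integral_of_le zero_le_one,
    intervalIntegral.integral_eq_sub_of_hasDerivAt_of_le zero_le_one hcont hderiv
      (hθ.intervalIntegrable_of_Icc zero_le_one)]
  simp

/-! #### The fundamental theorem of calculus along a face direction -/

/-- **Face FTC**: for `y = (q, u)` in the open `(n+1)`-cube, the integral over `t ∈ (0,1)` of
the `t`-derivative of `Ω(insertNth j t q, u) · gⱼ(insertNth j t q)` is the difference of the face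
integrands at `pⱼ = 1` and `pⱼ = 0`. [folklore] -/
theorem integral_face_deriv (j : Fin (n + 1)) {y : Fin (n + 1) → ℝ}
    (hy : y ∈ unitCube (n + 1)) :
    ∫ t in Ioo (0 : ℝ) 1,
      ((D.a j (y (Fin.last n) • (j.insertNth t (Fin.init y) : Fin (n + 1) → ℝ)) +
          y (Fin.last n) * fderiv ℝ (D.a j)
            (y (Fin.last n) • (j.insertNth t (Fin.init y) : Fin (n + 1) → ℝ))
            (j.insertNth t (Fin.init y))) * D.g j (j.insertNth t (Fin.init y)) +
        unfolding D.a (j.insertNth t (Fin.init y)) (y (Fin.last n)) *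
          fderiv ℝ (D.g j) (j.insertNth t (Fin.init y)) (Pi.single j 1)) =
      D.faceIntegrand j 1 y - D.faceIntegrand j 0 y := by
  set q : Fin n → ℝ := Fin.init y with hq_def
  set u : ℝ := y (Fin.last n) with hu_def
  have hyI : y ∈ Icc (0 : Fin (n + 1) → ℝ) 1 := unitCube_subset_Icc _ hy
  have hqI : q ∈ Icc (0 : Fin n → ℝ) 1 := init_mem_Icc' hyI
  have huI : u ∈ Icc (0 : ℝ) 1 := apply_mem_Icc hyI _
  have hxI : ∀ t ∈ Icc (0 : ℝ) 1, (j.insertNth t q : Fin (n + 1) → ℝ) ∈ Icc 0 1 :=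
    fun t ht => insertNth_mem_Icc' j ht hqI
  have hxU : ∀ t ∈ Icc (0 : ℝ) 1, (j.insertNth t q : Fin (n + 1) → ℝ) ∈ D.U :=
    fun t ht => D.mem_U_of_mem_Icc (hxI t ht)
  have huxU : ∀ t ∈ Icc (0 : ℝ) 1, u • (j.insertNth t q : Fin (n + 1) → ℝ) ∈ D.U :=
    fun t ht => D.smul_mem_U_of_mem_Icc (hxI t ht) huI
  have hpath : Continuous fun t : ℝ => (j.insertNth t q : Fin (n + 1) → ℝ) :=
    Continuous.finInsertNth (A := fun _ : Fin (n + 1) => ℝ) j continuous_id continuous_const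
  -- the primitive and its continuity on `[0,1]`
  have hcont : ContinuousOn
      (fun s => unfolding D.a (j.insertNth s q) u * D.g j (j.insertNth s q)) (Icc 0 1) :=
    (D.continuousOn_unfolding_comp hpath.continuousOn continuousOn_const huxU).mul
      (D.continuousOn_g_comp j hpath.continuousOn hxU)
  -- the derivative
  have hderiv : ∀ t ∈ Ioo (0 : ℝ) 1, HasDerivAt
      (fun s => unfolding D.a (j.insertNth s q) u * D.g j (j.insertNth s q))
      ((D.a j (u • (j.insertNth t q : Fin (n + 1) → ℝ)) +
          u * fderiv ℝ (D.a j) (u • (j.insertNth t q : Fin (n + 1) → ℝ)) (j.insertNth t q)) *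
          D.g j (j.insertNth t q) +
        unfolding D.a (j.insertNth t q) u *
          fderiv ℝ (D.g j) (j.insertNth t q) (Pi.single j 1)) t := by
    intro t ht
    have htI : t ∈ Icc (0 : ℝ) 1 := Ioo_subset_Icc_self ht
    have h1 := D.hasDerivAt_unfolding_insertNth j q u t (huxU t htI)
    have h2 : HasDerivAt (fun s => D.g j (j.insertNth s q))
        (fderiv ℝ (D.g j) (j.insertNth t q) (Pi.single j 1)) t :=
      (D.hasFDerivAt_g j (hxU t htI)).comp_hasDerivAt t (hasDerivAt_insertNth j q t)
    exact h1.mul h2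
  -- the derivative is continuous on `[0,1]`
  have hint : ContinuousOn (fun t =>
      (D.a j (u • (j.insertNth t q : Fin (n + 1) → ℝ)) +
          u * fderiv ℝ (D.a j) (u • (j.insertNth t q : Fin (n + 1) → ℝ)) (j.insertNth t q)) *
          D.g j (j.insertNth t q) +
        unfolding D.a (j.insertNth t q) u *
          fderiv ℝ (D.g j) (j.insertNth t q) (Pi.single j 1)) (Icc 0 1) :=
    ((D.continuousOn_radial_comp j hpath.continuousOn continuousOn_const huxU).mul
      (D.continuousOn_g_comp j hpath.continuousOn hxU)).add
      ((D.continuousOn_unfolding_comp hpath.continuousOn continuousOn_const huxU).mul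
        (D.continuousOn_fderiv_g_comp j hpath.continuousOn hxU continuousOn_const))
  rw [← integral_Ioc_eq_integral_Ioo, ← intervalIntegral.integral_of_le zero_le_one,
    intervalIntegral.integral_eq_sub_of_hasDerivAt_of_le zero_le_one hcont hderiv
      (hint.intervalIntegrable_of_Icc zero_le_one)]
  simp only [faceIntegrand, hq_def, hu_def]

/-! #### Integrability on the cubes -/

/-- A function continuous on the closed unit cube is integrable on the open unit cube.
[folklore] -/
theorem _root_.Literature.NumberTheory.Transcendental.KZ.integrableOn_unitCube_of_continuousOn
    {k : ℕ} {F : (Fin k → ℝ) → ℝ} (hF : ContinuousOn F (Icc (0 : Fin k → ℝ) 1)) :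
    IntegrableOn F (unitCube k) :=
  (hF.integrableOn_compact isCompact_Icc).mono_set (unitCube_subset_Icc k)

/-- `Fin.init` is continuous. [folklore] -/
theorem _root_.Literature.NumberTheory.Transcendental.KZ.continuous_init {k : ℕ} :
    Continuous fun z : Fin (k + 1) → ℝ => (Fin.init z : Fin k → ℝ) :=
  continuous_pi fun i => continuous_apply (Fin.castSucc i)

/-- The face integrands are continuous on the closed cube. [folklore] -/
theorem continuousOn_faceIntegrand (j : Fin (n + 1)) {c : ℝ} (hc : c ∈ Icc (0 : ℝ) 1) :
    ContinuousOn (D.faceIntegrand j c) (Icc (0 : Fin (n + 1) → ℝ) 1) := by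
  have hP : Continuous fun y : Fin (n + 1) → ℝ => (j.insertNth c (Fin.init y) : Fin (n + 1) → ℝ) :=
    Continuous.finInsertNth (A := fun _ : Fin (n + 1) => ℝ) j continuous_const continuous_init
  have hPI : ∀ y ∈ Icc (0 : Fin (n + 1) → ℝ) 1,
      (j.insertNth c (Fin.init y) : Fin (n + 1) → ℝ) ∈ Icc 0 1 :=
    fun y hy => insertNth_mem_Icc' j hc (init_mem_Icc' hy)
  have hu : Continuous fun y : Fin (n + 1) → ℝ => y (Fin.last n) := continuous_apply _
  exact (D.continuousOn_unfolding_comp hP.continuousOn hu.continuousOn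
    (fun y hy => D.smul_mem_U_of_mem_Icc (hPI y hy) (apply_mem_Icc hy _))).mul
    (D.continuousOn_g_comp j hP.continuousOn fun y hy => D.mem_U_of_mem_Icc (hPI y hy))

/-- The wedge integrand is continuous on the closed cube. [folklore] -/
theorem continuousOn_wedgeIntegrand :
    ContinuousOn D.wedgeIntegrand (Icc (0 : Fin (n + 1) → ℝ) 1) := by
  unfold wedgeIntegrand
  refine continuousOn_finsetSum _ fun j _ => continuousOn_const.mul ?_
  exact (D.continuousOn_a_comp j continuousOn_id fun p hp => D.mem_U_of_mem_Icc hp).mul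
    (D.continuousOn_g_comp j continuousOn_id fun p hp => D.mem_U_of_mem_Icc hp)

/-- The divergence integrand is continuous on the closed cube. [folklore] -/
theorem continuousOn_divIntegrand :
    ContinuousOn D.divIntegrand (Icc (0 : Fin (n + 2) → ℝ) 1) := by
  unfold divIntegrand
  have hPI : ∀ z ∈ Icc (0 : Fin (n + 2) → ℝ) 1, Fin.init z ∈ Icc (0 : Fin (n + 1) → ℝ) 1 :=
    fun z hz => init_mem_Icc hz
  have hu : Continuous fun z : Fin (n + 2) → ℝ => z (Fin.last (n + 1)) := continuous_apply _
  refine (D.continuousOn_unfolding_comp continuous_init.continuousOn hu.continuousOn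
    fun z hz => D.smul_mem_U_of_mem_Icc (hPI z hz) (apply_mem_Icc hz _)).mul ?_
  refine continuousOn_finsetSum _ fun j _ => continuousOn_const.mul ?_
  exact D.continuousOn_fderiv_g_comp j continuous_init.continuousOn
    (fun z hz => D.mem_U_of_mem_Icc (hPI z hz)) continuousOn_const

/-- The derivative integrand of the `j`-th face term is continuous on the closed cube.
[folklore] -/
theorem continuousOn_faceDeriv (j : Fin (n + 1)) :
    ContinuousOn (fun z : Fin (n + 2) → ℝ =>
      (D.a j (z (Fin.last (n + 1)) • Fin.init z) +
          z (Fin.last (n + 1)) * fderiv ℝ (D.a j) (z (Fin.last (n + 1)) • Fin.init z)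
            (Fin.init z)) * D.g j (Fin.init z) +
        unfolding D.a (Fin.init z) (z (Fin.last (n + 1))) *
          fderiv ℝ (D.g j) (Fin.init z) (Pi.single j 1)) (Icc (0 : Fin (n + 2) → ℝ) 1) := by
  have hPI : ∀ z ∈ Icc (0 : Fin (n + 2) → ℝ) 1, Fin.init z ∈ Icc (0 : Fin (n + 1) → ℝ) 1 :=
    fun z hz => init_mem_Icc hz
  have hPU : ∀ z ∈ Icc (0 : Fin (n + 2) → ℝ) 1, Fin.init z ∈ D.U :=
    fun z hz => D.mem_U_of_mem_Icc (hPI z hz)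
  have huPU : ∀ z ∈ Icc (0 : Fin (n + 2) → ℝ) 1, z (Fin.last (n + 1)) • Fin.init z ∈ D.U :=
    fun z hz => D.smul_mem_U_of_mem_Icc (hPI z hz) (apply_mem_Icc hz _)
  have hu : Continuous fun z : Fin (n + 2) → ℝ => z (Fin.last (n + 1)) := continuous_apply _
  exact ((D.continuousOn_radial_comp j continuous_init.continuousOn hu.continuousOn huPU).mul
    (D.continuousOn_g_comp j continuous_init.continuousOn hPU)).add
    ((D.continuousOn_unfolding_comp continuous_init.continuousOn hu.continuousOn huPU).mul
      (D.continuousOn_fderiv_g_comp j continuous_init.continuousOn hPU continuousOn_const))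

/-- The radial integrand (`Σⱼ (−1)ʲ ∂ᵤ(u aⱼ(u p)) gⱼ(p)`) is continuous on the closed cube.
[folklore] -/
theorem continuousOn_radialIntegrand :
    ContinuousOn (fun z : Fin (n + 2) → ℝ => ∑ j : Fin (n + 1), (-1 : ℝ) ^ (j : ℕ) *
      ((D.a j (z (Fin.last (n + 1)) • Fin.init z) +
          z (Fin.last (n + 1)) * fderiv ℝ (D.a j) (z (Fin.last (n + 1)) • Fin.init z)
            (Fin.init z)) * D.g j (Fin.init z))) (Icc (0 : Fin (n + 2) → ℝ) 1) := by
  have hPI : ∀ z ∈ Icc (0 : Fin (n + 2) → ℝ) 1, Fin.init z ∈ Icc (0 : Fin (n + 1) → ℝ) 1 :=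
    fun z hz => init_mem_Icc hz
  have hu : Continuous fun z : Fin (n + 2) → ℝ => z (Fin.last (n + 1)) := continuous_apply _
  refine continuousOn_finsetSum _ fun j _ => continuousOn_const.mul ?_
  exact (D.continuousOn_radial_comp j continuous_init.continuousOn hu.continuousOn
    fun z hz => D.smul_mem_U_of_mem_Icc (hPI z hz) (apply_mem_Icc hz _)).mul
    (D.continuousOn_g_comp j continuous_init.continuousOn
      fun z hz => D.mem_U_of_mem_Icc (hPI z hz))

/-! #### The face terms as integrals over the `(n+2)`-cube -/

/-- **Face term**: the difference of the two `j`-th face representations is the integral over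
the `(n+2)`-cube of the derivative integrand (Fubini along `pⱼ` and the face FTC). [folklore] -/
theorem value_face_sub (j : Fin (n + 1)) {r₀ r₁ : Fin (n + 1) → IntegralRep (n + 1)}
    {rW : IntegralRep (n + 1)} {rD : IntegralRep (n + 2)} (h : D.IsCarriedBy r₀ r₁ rW rD) :
    (r₁ j).value - (r₀ j).value = ∫ z in unitCube (n + 2),
      ((D.a j (z (Fin.last (n + 1)) • Fin.init z) +
          z (Fin.last (n + 1)) * fderiv ℝ (D.a j) (z (Fin.last (n + 1)) • Fin.init z)
            (Fin.init z)) * D.g j (Fin.init z) +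
        unfolding D.a (Fin.init z) (z (Fin.last (n + 1))) *
          fderiv ℝ (D.g j) (Fin.init z) (Pi.single j 1)) := by
  obtain ⟨h₀d, h₀, h₁d, h₁, -, -, -, -⟩ := h
  have hmeas : MeasurableSet (unitCube (n + 1)) := (isOpen_unitCube _).measurableSet
  have hv : ∀ (c : ℝ) (r : IntegralRep (n + 1)), r.domain = unitCube (n + 1) →
      EqOn r.integrand (D.faceIntegrand j c) (unitCube (n + 1)) →
      r.value = ∫ y in unitCube (n + 1), D.faceIntegrand j c y := by
    intro c r hd he
    rw [IntegralRep.value, hd]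
    exact setIntegral_congr_fun hmeas he
  rw [hv 1 (r₁ j) (h₁d j) (h₁ j), hv 0 (r₀ j) (h₀d j) (h₀ j), ← integral_sub
    (integrableOn_unitCube_of_continuousOn
      (D.continuousOn_faceIntegrand j ⟨zero_le_one, le_rfl⟩))
    (integrableOn_unitCube_of_continuousOn
      (D.continuousOn_faceIntegrand j ⟨le_rfl, zero_le_one⟩)),
    setIntegral_unitCube_succ j.castSucc _
      (integrableOn_unitCube_of_continuousOn (D.continuousOn_faceDeriv j))]
  refine setIntegral_congr_fun hmeas fun y hy => ?_
  rw [← D.integral_face_deriv j hy]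
  simp only [init_insertNth_castSucc, insertNth_castSucc_apply_last]

/-! #### The radial term -/

/-- **Radial term**: the integral over the `(n+2)`-cube of `Σⱼ (−1)ʲ ∂ᵤ(u aⱼ(u p)) gⱼ(p)` is the
value of the wedge representation (Fubini along `u` and the radial FTC). [folklore] -/
theorem integral_radialIntegrand {r₀ r₁ : Fin (n + 1) → IntegralRep (n + 1)}
    {rW : IntegralRep (n + 1)} {rD : IntegralRep (n + 2)} (h : D.IsCarriedBy r₀ r₁ rW rD) :
    ∫ z in unitCube (n + 2), ∑ j : Fin (n + 1), (-1 : ℝ) ^ (j : ℕ) *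
      ((D.a j (z (Fin.last (n + 1)) • Fin.init z) +
          z (Fin.last (n + 1)) * fderiv ℝ (D.a j) (z (Fin.last (n + 1)) • Fin.init z)
            (Fin.init z)) * D.g j (Fin.init z)) = rW.value := by
  obtain ⟨-, -, -, -, hWd, hW, -, -⟩ := h
  have hmeas : MeasurableSet (unitCube (n + 1)) := (isOpen_unitCube _).measurableSet
  rw [IntegralRep.value, hWd, setIntegral_congr_fun hmeas hW,
    setIntegral_unitCube_succ (Fin.last (n + 1)) _
      (integrableOn_unitCube_of_continuousOn D.continuousOn_radialIntegrand)]
  refine setIntegral_congr_fun hmeas fun p hp => ?_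
  have hpI : p ∈ Icc (0 : Fin (n + 1) → ℝ) 1 := unitCube_subset_Icc _ hp
  simp only [Fin.insertNth_last', Fin.init_snoc, Fin.snoc_last]
  -- integrate the sum term by term
  have hint : ∀ j : Fin (n + 1), IntegrableOn
      (fun u : ℝ => (-1 : ℝ) ^ (j : ℕ) *
        ((D.a j (u • p) + u * fderiv ℝ (D.a j) (u • p) p) * D.g j p)) (Ioo (0 : ℝ) 1) := by
    intro j
    refine (ContinuousOn.integrableOn_compact isCompact_Icc ?_).mono_set Ioo_subset_Icc_self
    exact continuousOn_const.mul ((D.continuousOn_radial_comp j continuousOn_const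
      continuousOn_id fun u hu => D.smul_mem_U_of_mem_Icc hpI hu).mul continuousOn_const)
  rw [integral_finsetSum _ fun j _ => hint j]
  unfold wedgeIntegrand
  refine Finset.sum_congr rfl fun j _ => ?_
  rw [integral_const_mul, integral_mul_const, D.integral_radial j hpI]

/-! #### Soundness -/

/-- **Soundness of the unfolded Stokes relators** (Stokes' formula on the unit cube for
`f η`, `f = ∫₀¹ Ω(·, u) du`): the relator of representations carrying an unfolded Stokes datum
evaluates to `0`. The face terms are, by Fubini along `pⱼ` and the fundamental theorem of
calculus, the integrals over `D × (0,1)` of `∂ⱼ(Ω gⱼ) = (∂ⱼΩ) gⱼ + Ω ∂ⱼgⱼ`; closedness of `ω`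
gives `∂ⱼΩ(p,u) = ∂ᵤ(u · aⱼ(u p))`, whose `u`-integral is `aⱼ(p)` (Fubini along `u`, FTC), so the
alternating sum of the face terms is `∫_D ω ∧ η + ∫_{D × (0,1)} Ω dη`.
[Kontsevich–Zagier 2001, §1.2 rule 3)] [cite: KontsevichZagierPeriods2001, §1.2 rule 3] -/
theorem eval_stokesRelator_eq_zero {r₀ r₁ : Fin (n + 1) → IntegralRep (n + 1)}
    {rW : IntegralRep (n + 1)} {rD : IntegralRep (n + 2)} (h : D.IsCarriedBy r₀ r₁ rW rD) :
    eval (stokesRelator r₀ r₁ rW rD) = 0 := by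
  -- notation for the three integrands on the `(n+2)`-cube
  set Ψ : Fin (n + 1) → (Fin (n + 2) → ℝ) → ℝ := fun j z =>
    (D.a j (z (Fin.last (n + 1)) • Fin.init z) +
        z (Fin.last (n + 1)) * fderiv ℝ (D.a j) (z (Fin.last (n + 1)) • Fin.init z)
          (Fin.init z)) * D.g j (Fin.init z) +
      unfolding D.a (Fin.init z) (z (Fin.last (n + 1))) *
        fderiv ℝ (D.g j) (Fin.init z) (Pi.single j 1) with hΨ
  set Θ : (Fin (n + 2) → ℝ) → ℝ := fun z => ∑ j : Fin (n + 1), (-1 : ℝ) ^ (j : ℕ) *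
    ((D.a j (z (Fin.last (n + 1)) • Fin.init z) +
        z (Fin.last (n + 1)) * fderiv ℝ (D.a j) (z (Fin.last (n + 1)) • Fin.init z)
          (Fin.init z)) * D.g j (Fin.init z)) with hΘ
  have hface : ∀ j, (r₁ j).value - (r₀ j).value = ∫ z in unitCube (n + 2), Ψ j z :=
    fun j => D.value_face_sub j h
  have hrad : ∫ z in unitCube (n + 2), Θ z = rW.value := D.integral_radialIntegrand h
  have hdiv : ∫ z in unitCube (n + 2), D.divIntegrand z = rD.value := by
    obtain ⟨-, -, -, -, -, -, hDd, hD⟩ := h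
    rw [IntegralRep.value, hDd]
    exact (setIntegral_congr_fun (isOpen_unitCube _).measurableSet hD).symm
  -- the pointwise identity `Σⱼ (−1)ʲ Ψⱼ = Θ + div`
  have hpt : ∀ z, ∑ j : Fin (n + 1), (-1 : ℝ) ^ (j : ℕ) * Ψ j z = Θ z + D.divIntegrand z := by
    intro z
    simp only [hΨ, hΘ, divIntegrand, mul_add, Finset.sum_add_distrib, Finset.mul_sum]
    congr 1
    refine Finset.sum_congr rfl fun j _ => ?_
    ring
  -- integrability
  have hΨint : ∀ j, IntegrableOn (Ψ j) (unitCube (n + 2)) :=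
    fun j => integrableOn_unitCube_of_continuousOn (D.continuousOn_faceDeriv j)
  have hΘint : IntegrableOn Θ (unitCube (n + 2)) :=
    integrableOn_unitCube_of_continuousOn D.continuousOn_radialIntegrand
  have hdivint : IntegrableOn D.divIntegrand (unitCube (n + 2)) :=
    integrableOn_unitCube_of_continuousOn D.continuousOn_divIntegrand
  -- evaluate the relator
  have hsum : ∑ j : Fin (n + 1), ((-1 : ℤ) ^ (j : ℕ)) • ((r₁ j).value - (r₀ j).value) =
      rW.value + rD.value := by
    calc ∑ j : Fin (n + 1), ((-1 : ℤ) ^ (j : ℕ)) • ((r₁ j).value - (r₀ j).value)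
        = ∑ j : Fin (n + 1), ∫ z in unitCube (n + 2), (-1 : ℝ) ^ (j : ℕ) * Ψ j z := by
          refine Finset.sum_congr rfl fun j _ => ?_
          rw [hface j, integral_const_mul, zsmul_eq_mul]
          simp
      _ = ∫ z in unitCube (n + 2), ∑ j : Fin (n + 1), (-1 : ℝ) ^ (j : ℕ) * Ψ j z :=
          (integral_finsetSum _ fun j _ => (hΨint j).const_mul _).symm
      _ = ∫ z in unitCube (n + 2), (Θ z + D.divIntegrand z) :=
          integral_congr_ae (Filter.Eventually.of_forall hpt)
      _ = rW.value + rD.value := by rw [integral_add hΘint hdivint, hrad, hdiv]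
  simp only [stokesRelator, map_sub, map_sum, map_zsmul, eval_of]
  rw [hsum]
  ring

end UnfoldedStokesData

/-- **Soundness of the unfolded Stokes relators**: every element of `unfoldedStokesRel`
evaluates to `0` under `KZ.eval` (Stokes' formula on the unit cube for `f η` with the abelian
integral `f = ∫₀¹ Ω(·,u) du`, proved by Fubini and the fundamental theorem of calculus).
[Kontsevich–Zagier 2001, §1.2 rule 3)] [cite: KontsevichZagierPeriods2001, §1.2 rule 3] -/
theorem eval_eq_zero_of_mem_unfoldedStokesRel {c : FormalRep} (hc : c ∈ unfoldedStokesRel) :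
    eval c = 0 := by
  obtain ⟨n, D, r₀, r₁, rW, rD, h, rfl⟩ := hc
  exact D.eval_stokesRelator_eq_zero h

/-- The unfolded Stokes relators lie in the kernel of evaluation. [cite: KontsevichZagierPeriods2001, §1.2 rule 3] -/
theorem unfoldedStokesRel_subset_ker_eval : unfoldedStokesRel ⊆ (eval.ker : Set FormalRep) :=
  fun _ hc => AddMonoidHom.mem_ker.2 (eval_eq_zero_of_mem_unfoldedStokesRel hc)

/-- **Soundness of the Stokes relations**: the subgroup generated by the four KZ moves and the
unfolded Stokes relators lies in the kernel of evaluation (so thesis part B, `eval.ker ≤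
stokesRelations`, asserts an equality). [cite: KontsevichZagierPeriods2001, §1.2] -/
theorem stokesRelations_le_ker_eval : stokesRelations ≤ eval.ker := by
  rw [stokesRelations_def, AddSubgroup.closure_le]
  rintro c (hc | hc)
  · have h : c ∈ relations := AddSubgroup.subset_closure hc
    exact relations_le_ker_eval_holds h
  · exact unfoldedStokesRel_subset_ker_eval hc

end Soundness

end KZ

end Literature.NumberTheory.Transcendental
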